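import Literature.Combinatorics.SimpleGraph.BondySimonovits
import Literature.Combinatorics.SimpleGraph.GirthBounds
import HarnessLib
import Mathlib.Combinatorics.SimpleGraph.DegreeSum
import Mathlib.Combinatorics.SimpleGraph.Coloring.Vertex
import Literature.Combinatorics.SimpleGraph.BondySimonovitsLemma2

/-!
# Cycles of even length in graphs (Bondy–Simonovits 1974, Theorem 1) — discharge

Topic `Literature/Combinatorics/SimpleGraph`. Discharges the named fact
`Literature.Combinatorics.SimpleGraph.BondySimonovits1974_thm1` (`BondySimonovits.lean`), i.e.
**Theorem 1** of [BondySimonovits1974] (p. 98) as printed: "If `e(Gⁿ) > 100 k n^{1+1/k}`, then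
`C^{2l} ⊂ Gⁿ` for every integer `l ∈ [k, k n^{1/k}]`."

The tree already contains a complete proof of the same theorem with B. Bollobás's better constant
`90` (*Extremal Graph Theory*, Ch. III Thm. 5.11, itself the Bondy–Simonovits argument):
`Literature.Combinatorics.SimpleGraph.Bollobas1978_III_thm_5_11_holds` in `GirthBounds.lean`
(breadth-first levels, Erdős's bipartite half, minimum-degree core, cycle-with-chord path lemma).
Since `100 k n^{1+1/k} ≥ 90 k n^{1+1/k}`, the printed statement is an immediate corollary; this
file records exactly that two-line deduction (library-first discharge; both facts have the same
binders: `G : SimpleGraph (Fin n)`, `G.edgeSet.ncard` edges, `1 ≤ k ≤ l ≤ k n^{1/k}` with real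
`n^{1/k} = Real.rpow`, conclusion a closed walk `p` with `p.IsCycle ∧ p.length = 2 l`).

## References

* J. A. Bondy, M. Simonovits, *Cycles of even length in graphs*, J. Combin. Theory Ser. B 16 (1974)
  97–105, doi:10.1016/0095-8956(74)90052-5 — Theorem 1, p. 98 (READ, held
  `paper:doi-10-1016-0095-8956-74-90052-5`). [BondySimonovits1974]
* B. Bollobás, *Extremal Graph Theory*, LMS Monographs 11, Academic Press 1978, Ch. III Thm. 5.11
  (the same theorem with constant `90`). [Bollobas1978]
-/

namespace Literature.Combinatorics.SimpleGraph

/-- **Bondy–Simonovits 1974, Theorem 1** holds (as printed, p. 98, constant `100`): a simple graph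
on `n` vertices with more than `100 k n^{1+1/k}` edges (`k ≥ 1`) contains a cycle of length exactly
`2l` for every integer `l` with `k ≤ l ≤ k n^{1/k}`. Immediate from the version with Bollobás's
constant `90`, `Bollobas1978_III_thm_5_11_holds` (`GirthBounds.lean`), as
`90 k n^{1+1/k} ≤ 100 k n^{1+1/k} < e(G)`. [cite: BondySimonovits1974, Theorem 1] -/
theorem BondySimonovits1974_thm1_holds : BondySimonovits1974_thm1 := by
  intro k N hk G hE l hkl hlk
  refine Bollobas1978_III_thm_5_11_holds k N hk G (lt_of_le_of_lt ?_ hE) l hkl hlk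
  have : (0 : ℝ) ≤ (k : ℝ) * (N : ℝ) ^ (1 + 1 / (k : ℝ)) := by positivity
  nlinarith

/-! ## A second, self-contained proof with a general constant (`c ≥ 86`)

`BondySimonovits1974.evenCycle_of_manyEdges` below proves Theorem 1 with `100` replaced by any real
`c ≥ 86`, directly from the paper's two lemmas as formalized in `BondySimonovitsLemma1.lean`
(Lemma 1: θ-graphs and `t`-periodic colourings, minimal cores) and `BondySimonovitsLemma2.lean`
(Lemma 2: BFS growth in a bipartite graph of minimum degree `≥ max(5 l n^{1/l}, 43 l)`), together
with Erdős's bipartite half `Bollobas1978_eq_0_4_holds`. The reduction Theorem 1* → Theorem 1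
(paper pp. 103–104: induction on `n`, deleting a vertex of valence `< E/n`) is done in one step by
the minimal core `BondySimonovits1974.exists_core` (all inner degrees `≥ e(B)/N > (c/2) k N^{1/k}`);
Lemma 2 is applied to the restriction of the bipartite half to the core with
`s = ⌊(c/2) k N^{1/k}⌋ + 1`, using `43 l ≤ 43 k N^{1/k} ≤ (c/2) k N^{1/k}` and
`5 l N^{1/l} ≤ 10 k N^{1/k}` (`BondySimonovits1974.exponent_bound`: `l N^{1/l} ≤ 2 k N^{1/k}` on
`[k, k N^{1/k}]`, from `λ M^{1/λ} ≤ M λ^{1/λ} ≤ 2M` for `1 ≤ λ ≤ M`, `λ ≤ 2^λ`). Both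
`BondySimonovits1974_thm1_holds` above (`c = 100`) and `Bollobas1978_III_thm_5_11_holds`
(`c = 90`) are instances.
-/

open Finset _root_.SimpleGraph

namespace BondySimonovits1974

/-- Elementary exponent bookkeeping for Theorem 1: for `1 ≤ k ≤ l ≤ k N^{1/k}` one has
`l · N^{1/l} ≤ 2k · N^{1/k}` (write `l = λ k`, `N^{1/k} = M ≥ λ ≥ 1`; then
`λ M^{1/λ} = M · λ (M^{1/λ - 1}) ≤ M λ^{1/λ} ≤ 2M` because `λ ≤ 2^λ`). [folklore] -/
theorem exponent_bound (k l N : ℕ) (hk : 1 ≤ k) (hkl : k ≤ l)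
    (hlk : (l : ℝ) ≤ k * (N : ℝ) ^ (1 / (k : ℝ))) (hN : 1 ≤ N) :
    (l : ℝ) * (N : ℝ) ^ (1 / (l : ℝ)) ≤ 2 * k * (N : ℝ) ^ (1 / (k : ℝ)) := by
  have h2pow : ∀ y : ℝ, 1 ≤ y → y ≤ (2 : ℝ) ^ y := by
    intro y hy
    have hfl := Nat.floor_le (by linarith : 0 ≤ y)
    have hlt := Nat.lt_floor_add_one y
    have hnat : ((⌊y⌋₊ + 1 : ℕ) : ℝ) ≤ (2 : ℝ) ^ (⌊y⌋₊ : ℝ) := by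
      rw [Real.rpow_natCast]
      exact_mod_cast Nat.lt_two_pow_self
    have hmono : (2 : ℝ) ^ (⌊y⌋₊ : ℝ) ≤ 2 ^ y :=
      Real.rpow_le_rpow_of_exponent_le (by norm_num) hfl
    push_cast at hnat
    linarith
  set M : ℝ := (N : ℝ) ^ (1 / (k : ℝ)) with hM
  set lam : ℝ := (l : ℝ) / k with hlam
  have hk0 : (0 : ℝ) < k := by exact_mod_cast hk
  have hl0 : (0 : ℝ) < l := by exact_mod_cast (lt_of_lt_of_le hk hkl)
  have hN1 : (1 : ℝ) ≤ N := by exact_mod_cast hN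
  have hM1 : 1 ≤ M := Real.one_le_rpow hN1 (by positivity)
  have hlam1 : 1 ≤ lam := by
    rw [hlam, le_div_iff₀ hk0, one_mul]; exact_mod_cast hkl
  have hlamM : lam ≤ M := by
    rw [hlam, div_le_iff₀ hk0]; linarith
  have hlam0 : 0 < lam := by linarith
  have hNl : (N : ℝ) ^ (1 / (l : ℝ)) = M ^ (1 / lam) := by
    rw [hM, ← Real.rpow_mul (by positivity)]
    congr 1
    rw [hlam]; field_simp
  have hexp : 1 / lam - 1 ≤ 0 := by
    have : 1 / lam ≤ 1 := by rw [div_le_one hlam0]; exact hlam1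
    linarith
  have h1 : M ^ (1 / lam - 1) ≤ lam ^ (1 / lam - 1) := Real.rpow_le_rpow_of_nonpos hlam0 hlamM hexp
  have h2 : M ^ (1 / lam) = M * M ^ (1 / lam - 1) := by
    rw [Real.rpow_sub_one (by linarith : M ≠ 0)]; field_simp
  have h3 : lam * lam ^ (1 / lam - 1) = lam ^ (1 / lam) := by
    rw [Real.rpow_sub_one hlam0.ne']; field_simp
  have h4 : lam ^ (1 / lam) ≤ 2 := by
    have hle : lam ≤ 2 ^ lam := h2pow lam hlam1
    calc lam ^ (1 / lam) ≤ ((2 : ℝ) ^ lam) ^ (1 / lam) :=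
          Real.rpow_le_rpow hlam0.le hle (by positivity)
      _ = 2 := by
          rw [← Real.rpow_mul (by norm_num)]
          have : lam * (1 / lam) = 1 := by field_simp
          rw [this, Real.rpow_one]
  calc (l : ℝ) * (N : ℝ) ^ (1 / (l : ℝ)) = k * (lam * M ^ (1 / lam)) := by
        rw [hNl, hlam]; field_simp
    _ = k * M * (lam * M ^ (1 / lam - 1)) := by rw [h2]; ring
    _ ≤ k * M * (lam * lam ^ (1 / lam - 1)) := by gcongr
    _ = k * M * lam ^ (1 / lam) := by rw [h3]
    _ ≤ k * M * 2 := by gcongr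
    _ = 2 * k * M := by ring

/-- **Theorem 1 of Bondy–Simonovits with a general constant.** For every real `c ≥ 86`, every
positive integer `k` and every graph `G` on `N` vertices with more than `c·k·N^{1+1/k}` edges, `G`
contains a cycle of length exactly `2l` for every integer `l` with `k ≤ l ≤ k N^{1/k}`. (The paper
states `c = 100`; Bollobás, *Extremal Graph Theory* III.5.11, prints `90`; the argument below needs
`c/2 ≥ 43`.)

Proof (following the paper, pp. 99–104, with the simplifications recorded in
`BondySimonovitsLemma1.lean` / `BondySimonovitsLemma2.lean`): pass to a bipartite subgraph `B` with
`e(B) ≥ e(G)/2` (`Bollobas1978_eq_0_4_holds`), then to a minimal core `S` of `B`, all of whose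
inner degrees are `≥ e(B)/N > (c/2) k N^{1/k}` (`exists_core`; this replaces the induction on `n`
of the paper's Theorem 1*, which deletes one vertex of valence `< E/n` at a time); the restriction
`H` of `B` to `S` is bipartite with minimum degree `s > (c/2) k N^{1/k} ≥ 43 l` and
`s ≥ 10 k N^{1/k} ≥ 5 l N^{1/l}` (`exponent_bound`), so Lemma 2 (`lemma2`) yields
`C_{2l} ⊆ H ⊆ G`. [cite: BondySimonovits1974, Theorem 1] -/
theorem evenCycle_of_manyEdges (c : ℝ) (hc : 86 ≤ c) (k N : ℕ) (hk : 1 ≤ k)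
    (G : _root_.SimpleGraph (Fin N))
    (hE : c * k * (N : ℝ) ^ (1 + 1 / (k : ℝ)) < (G.edgeSet.ncard : ℝ))
    (l : ℕ) (hkl : k ≤ l) (hlk : (l : ℝ) ≤ k * (N : ℝ) ^ (1 / (k : ℝ))) :
    ∃ (u : Fin N) (p : G.Walk u u), p.IsCycle ∧ p.length = 2 * l := by
  classical
  -- Erdős: a bipartite subgraph with at least half of the edges
  obtain ⟨B, hBG, hBbip, hBe⟩ := Bollobas1978_eq_0_4_holds (Fin N) G
  rw [← coe_edgeFinset, Set.ncard_coe_finset] at hE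
  rw [← coe_edgeFinset, ← coe_edgeFinset, Set.ncard_coe_finset, Set.ncard_coe_finset] at hBe
  set m := B.edgeFinset.card with hm
  have hc0 : 0 ≤ c := by linarith
  have hk0 : (0 : ℝ) < k := by exact_mod_cast hk
  have hrpow0 : (0 : ℝ) ≤ (N : ℝ) ^ (1 + 1 / (k : ℝ)) := by positivity
  have hmE : c / 2 * k * (N : ℝ) ^ (1 + 1 / (k : ℝ)) < m := by
    have : (G.edgeFinset.card : ℝ) ≤ 2 * m := by exact_mod_cast hBe
    linarith
  have hm1 : 1 ≤ m := by
    have h0 : 0 ≤ c / 2 * k * (N : ℝ) ^ (1 + 1 / (k : ℝ)) :=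
      mul_nonneg (mul_nonneg (by linarith) hk0.le) hrpow0
    have : (0 : ℝ) < m := lt_of_le_of_lt h0 hmE
    exact_mod_cast this
  have hN1 : 1 ≤ N := by
    by_contra hN0
    have hN0 : N = 0 := by omega
    subst hN0
    have h0 := B.card_edgeFinset_le_card_choose_two
    rw [Fintype.card_fin] at h0
    have : B.edgeFinset.card = 0 := Nat.le_zero.mp (by simpa using h0)
    omega
  have hN0 : (0 : ℝ) < N := by exact_mod_cast hN1
  -- the minimal core of `B`
  have hsumdeg : ∑ w ∈ (Finset.univ : Finset (Fin N)), (B.neighborFinset w ∩ Finset.univ).card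
      = 2 * m := by
    simp only [Finset.inter_univ, card_neighborFinset_eq_degree]
    rw [sum_degrees_eq_twice_card_edges]
  obtain ⟨S, -, hSa, hdegS, -⟩ := exists_core (G := B) (2 * m - 1) N Finset.univ (by
    rw [hsumdeg, Finset.card_univ, Fintype.card_fin]
    have e : (2 * m - 1) * N + N = N * (2 * m) := by
      rw [mul_comm N (2 * m), ← Nat.add_one_mul]
      congr 1; omega
    omega)
  have hSne : S.Nonempty := by
    rw [Finset.nonempty_iff_ne_empty]; rintro rfl; simp at hSa
  have hdegS' : ∀ v ∈ S, m ≤ N * (B.neighborFinset v ∩ S).card := by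
    intro v hv
    have h := hdegS v hv
    rw [mul_assoc] at h
    generalize N * (B.neighborFinset v ∩ S).card = X at h ⊢
    omega
  -- the restriction `H` of `B` to the core
  let H : _root_.SimpleGraph (Fin N) :=
    { Adj := fun u v => B.Adj u v ∧ u ∈ S ∧ v ∈ S
      symm := ⟨fun u v h => ⟨h.1.symm, h.2.2, h.2.1⟩⟩
      loopless := ⟨fun u h => B.loopless.irrefl u h.1⟩ }
  have hHB : H ≤ B := fun u v h => h.1
  have hHG : H ≤ G := hHB.trans hBG
  obtain ⟨C⟩ := hBbip
  set side : Fin N → Bool := fun v => decide (C v = 0) with hside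
  have hsideH : ∀ u v, H.Adj u v → side u ≠ side v := by
    intro u v h
    have hC : C u ≠ C v := C.valid h.1
    have key : ∀ a b : Fin 2, a ≠ b → decide (a = 0) ≠ decide (b = 0) := by decide
    exact key _ _ hC
  obtain ⟨x, hx⟩ := hSne
  have hreachS : ∀ v, H.Reachable x v → v ∈ S := by
    intro v ⟨p⟩
    have : ∀ {u w : Fin N} (q : H.Walk u w), u ∈ S → w ∈ S := by
      intro u w q
      induction q with
      | nil => exact id
      | cons h _ ih => exact fun _ => ih h.2.2
    exact this p hx
  have hHdeg : ∀ v ∈ S, H.degree v = (B.neighborFinset v ∩ S).card := by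
    intro v hv
    rw [← card_neighborFinset_eq_degree]
    congr 1
    ext w
    simp only [mem_neighborFinset, Finset.mem_inter]
    exact ⟨fun h => ⟨h.1, h.2.2⟩, fun h => ⟨h.1, hv, h.2⟩⟩
  -- the minimum degree `s`
  have hkN0 : (0 : ℝ) ≤ k * (N : ℝ) ^ (1 / (k : ℝ)) := by positivity
  set T : ℝ := c / 2 * k * (N : ℝ) ^ (1 / (k : ℝ)) with hT
  have hT0 : 0 ≤ T := by
    rw [hT, mul_assoc]; exact mul_nonneg (by linarith) hkN0
  have hsplit : (N : ℝ) ^ (1 + 1 / (k : ℝ)) = N * (N : ℝ) ^ (1 / (k : ℝ)) := by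
    rw [Real.rpow_add hN0, Real.rpow_one]
  set s : ℕ := ⌊T⌋₊ + 1 with hs
  have hsT : T < s := by rw [hs]; push_cast; exact Nat.lt_floor_add_one T
  have hdegT : ∀ v ∈ S, T < ((B.neighborFinset v ∩ S).card : ℝ) := by
    intro v hv
    have h1 : (m : ℝ) ≤ N * ((B.neighborFinset v ∩ S).card : ℝ) := by
      exact_mod_cast hdegS' v hv
    have h2 : T * N < m := by
      calc T * N = c / 2 * k * (N * (N : ℝ) ^ (1 / (k : ℝ))) := by rw [hT]; ring
        _ < m := by rwa [hsplit] at hmE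
    by_contra hle
    push Not at hle
    have := mul_le_mul_of_nonneg_left hle hN0.le
    nlinarith
  have hdegs : ∀ v, H.Reachable x v → s ≤ H.degree v := by
    intro v hv
    have hvS := hreachS v hv
    rw [hHdeg v hvS, hs]
    have hlt : ⌊T⌋₊ < (B.neighborFinset v ∩ S).card := (Nat.floor_lt hT0).mpr (hdegT v hvS)
    omega
  -- the hypotheses of Lemma 2
  have hl1 : 1 ≤ l := hk.trans hkl
  have hc43 : 0 ≤ c / 2 - 43 := by linarith
  have hs43 : 43 * l ≤ s := by
    have h1 : (43 : ℝ) * l ≤ T := by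
      have := mul_nonneg hc43 hkN0
      rw [hT]; nlinarith
    have h2 : ((43 * l : ℕ) : ℝ) < s := by push_cast; linarith
    exact_mod_cast h2.le
  have hsn : 5 * (l : ℝ) * (Fintype.card (Fin N) : ℝ) ^ (1 / (l : ℝ)) ≤ s := by
    rw [Fintype.card_fin]
    have h1 := exponent_bound k l N hk hkl hlk hN1
    have h2 : 5 * ((l : ℝ) * (N : ℝ) ^ (1 / (l : ℝ))) ≤ T := by
      have := mul_nonneg hc43 hkN0
      rw [hT]; nlinarith
    linarith
  -- Lemma 2 in `H`, and back to `G`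
  obtain ⟨u, p, hp, hpl⟩ := lemma2 (H := H) side hsideH x s l hl1 hs43 hsn hdegs
  refine ⟨u, p.mapLe hHG, (Walk.isCycle_mapLe hHG).mpr hp, ?_⟩
  have h1 := (p.mapLe hHG).length_support
  have h2 := p.length_support
  rw [Walk.support_mapLe_eq_support] at h1
  omega

end BondySimonovits1974

end Literature.Combinatorics.SimpleGraph
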